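import Literature.Barriers.QuantumAdvantage.PPolyOraclesCompile
import Literature.Barriers.QuantumAdvantage.PPolyOraclesLemma82Proofs
import Literature.Computability.Cryptography.ZhandryPRFModProofs
import Literature.Computability.Cryptography.LubyRackoffHybridProofs
import Literature.Computability.Cryptography.LubyRackoffIdealProofs
import Literature.Computability.Cryptography.PseudorandomnessPRFProofs
import HarnessLib

/-!
# Aaronson–Chen 2017, Thm. 7.6: the assembly from the current frontier (HILL and the quantum machine)

Topic `Literature/Barriers/QuantumAdvantage`; sibling proof file of `PPolyOracles.lean` (the named
fact `aaronsonChen2017_thm76 : OWFExist → PPolyOracleSeparation`, S. Aaronson, L. Chen,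
*Complexity-theoretic foundations of quantum supremacy experiments*, CCC 2017, arXiv:1612.05903
[AaronsonChen2017], **Thm. 7.6** (p. 30): "Assuming the existence of one-way functions, there
exists an oracle `O ∈ P/poly` such that `BPP^O ≠ BQP^O`"), of its decomposition
`PPolyOraclesProofs.lean` / `PPolyOraclesThm76.lean` / `PPolyOraclesPPoly.lean` /
`PPolyOraclesCompile.lean`, and of the crypto proof files that have meanwhile DISCHARGED three of
the five leaves of `aaronsonChen2017_thm76_of_frontier₅` (`PPolyOraclesAssembly.lean`):

* Lemma 7.4 [HILL99, GGM86, LR88]: GGM is `PRFExist_of_PRGExist_holds`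
  (`PseudorandomnessPRFProofs.lean`) and Luby–Rackoff's `PRPExist_of_PRFExist` follows from the
  tree theorems `LubyRackoff.HybridStep_holds` (`LubyRackoffHybridProofs.lean`) and
  `LubyRackoff.MainLemma_holds` (`LubyRackoffIdealProofs.lean`) through the proved assembly
  `LubyRackoff.PRPExist_of_PRFExist_of` (`LubyRackoffIdeal.lean`) — `PRPExist_of_luby_rackoff`
  below; HILL (`PRGExist_iff_OWFExist`) remains a named fact;
* Lemma 7.5 (1) (both `PRP^raw` and `PRF^mod` are classically secure PRFs): the switching half is
  `aaronsonChen2017_lem75_prp_isPRF_holds` (`PRPSwitchingLemma.lean`), Zhandry's Claim 1 is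
  `aaronsonChen2017_lem75_prfMod_isPRF_holds` (`ZhandryPRFModProofs.lean`);
* the proof of Thm. 7.6 proper (p. 30): the diagonalization against `BPP^O` is proved in
  `PPolyOraclesThm76.lean`, its compilation leaf is `acLang_bppCompiles_holds`
  (`PPolyOraclesCompile.lean`), the sentence "each `f_n` has a polynomial-size circuit, and
  consequently `O ∈ P/poly`" is `aaronsonChen2017_thm76_ppoly_holds` (`PPolyOraclesPPoly.lean`);
* Lemma 7.5 (2)–(3) with the `BQP^O` machine ("apply Boneh and Lipton's quantum period finding
  algorithm", App. 13, p. 42), `aaronsonChen2017_lem75_quantum` (`PPolyOraclesThm76.lean`),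
  remains a named fact (its discharge, one uniform family of exact Clifford+T period-finding
  circuits with oracle gates, is under way in `PPolyOraclesLem75Circuit.lean`,
  `PPolyOraclesLem75Word.lean`, `PPolyOraclesLem75Law.lean`).

This file adds NO definition and NO named fact; it PROVES the assembly of Thm. 7.6 — and of the
barrier conjunction `PPolyOracles` (Thm. 8.1 being the tree theorem `aaronsonChen2017_thm81_holds`,
`PPolyOraclesLemma82Proofs.lean`) — from exactly the TWO named facts still undischarged on its
line, so that `aaronsonChen2017_thm76_holds` is the one-liner
`aaronsonChen2017_thm76_of_frontier₂ PRGExist_iff_OWFExist_holds aaronsonChen2017_lem75_quantum_holds`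
once they land. (The discharge name `PRPExist_of_PRFExist_holds` is left to the unit owning that
fact; here the Luby–Rackoff step is the local theorem `PRPExist_of_luby_rackoff`.)

## References

* S. Aaronson, L. Chen, CCC 2017, arXiv:1612.05903, Lemma 7.4, Lemma 7.5 (pp. 29–30), Thm. 7.6
  (proof, p. 30), App. 13 (p. 42), Thm. 8.1 (p. 32) [AaronsonChen2017].
* J. Håstad, R. Impagliazzo, L. A. Levin, M. Luby, SIAM J. Comput. 28 (1999), Thm. 1.1 [HILL1999].
* O. Goldreich, R. Goldwasser, S. Micali, J. ACM 33 (1986), Thm. 3 [GGM1986].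
* M. Luby, C. Rackoff, SIAM J. Comput. 17 (1988), Thm. 1 [LubyRackoff1988].
* M. Zhandry, FOCS 2012 (arXiv:1202.4236v2), Claim 1 [Zhandry2012].
-/

namespace Literature.Barriers.QuantumAdvantage

open Literature.Computability.Complexity Literature.Computability.Cryptography

/-- **Lemma 7.4, PRP half, is a theorem of the tree**: Luby–Rackoff's `PRFExist → PRPExist` from
the hybrid step and the main lemma, both proved (`LubyRackoff.HybridStep_holds`,
`LubyRackoff.MainLemma_holds`), through `LubyRackoff.PRPExist_of_PRFExist_of`.
[cite: AaronsonChen2017, Lemma 7.4 (p. 29)] [cite: Goldreich2001, Thm. 3.7.7 (pp. 203–205)]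
[cite: LubyRackoff1988, abstract (main result)] -/
theorem PRPExist_of_luby_rackoff : PRPExist_of_PRFExist :=
  LubyRackoff.PRPExist_of_PRFExist_of LubyRackoff.HybridStep_holds LubyRackoff.MainLemma_holds

/-- **Lemma 7.4 as printed, modulo HILL only**: "if one-way functions exist, then there exist
secure PRFs and PRPs" — GGM and Luby–Rackoff being theorems, the single named fact left on this
line is HILL, `PRGExist_iff_OWFExist`. [cite: AaronsonChen2017, Lemma 7.4 (p. 29)] -/
theorem aaronsonChen2017_lem74_of_HILL (hHILL : PRGExist_iff_OWFExist) :
    OWFExist → PRFExist ∧ PRPExist :=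
  aaronsonChen2017_lem74_of_parts hHILL PRFExist_of_PRGExist_holds PRPExist_of_luby_rackoff

/-- **§7.2–7.3 from the quantum machine alone**: the named fact
`aaronsonChen2017_thm76_of_prp : PRPExist → PPolyOracleSeparation` follows from the one remaining
leaf `aaronsonChen2017_lem75_quantum` (Lemma 7.5 (2)–(3) and the `BQP^O` machine), the four other
leaves of the proved diagonalization being theorems (`aaronsonChen2017_lem75_prp_isPRF_holds`,
`aaronsonChen2017_lem75_prfMod_isPRF_holds`, `acLang_bppCompiles_holds`,
`aaronsonChen2017_thm76_ppoly_holds`). [cite: AaronsonChen2017, Thm. 7.6 (proof, p. 30), Lemma 7.5] -/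
theorem aaronsonChen2017_thm76_of_prp_of_quantum
    (hq : Literature.Barriers.QuantumAdvantage.aaronsonChen2017_lem75_quantum) :
    aaronsonChen2017_thm76_of_prp :=
  aaronsonChen2017_thm76_of_prp_of_leaves₂ aaronsonChen2017_lem75_prfMod_isPRF_holds hq

/-- **Thm. 7.6 from the current frontier** — HILL (`PRGExist_iff_OWFExist`) and the quantum machine
of Lemma 7.5 (2)–(3) (`aaronsonChen2017_lem75_quantum`): GGM, Luby–Rackoff, both halves of
Lemma 7.5 (1), the compilation of `BPP^O` machines into PRF adversaries, the `P/poly` bound and the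
diagonalization are theorems of the tree. The discharge `aaronsonChen2017_thm76_holds` is this
theorem applied to their `_holds`. [cite: AaronsonChen2017, Thm. 7.6 (p. 30), Lemma 7.4, Lemma 7.5] -/
theorem aaronsonChen2017_thm76_of_frontier₂ (hHILL : PRGExist_iff_OWFExist)
    (hq : Literature.Barriers.QuantumAdvantage.aaronsonChen2017_lem75_quantum) :
    aaronsonChen2017_thm76 :=
  aaronsonChen2017_thm76_of_parts' hHILL PRFExist_of_PRGExist_holds PRPExist_of_luby_rackoff
    (aaronsonChen2017_thm76_of_prp_of_quantum hq)

/-- **The separation itself from the frontier and one-way functions**: given HILL and the quantum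
machine, `OWFExist` yields an oracle `O ∈ P/poly` with `BPP^O ≠ BQP^O`.
[cite: AaronsonChen2017, Thm. 7.6 (p. 30)] -/
theorem pPolyOracleSeparation_of_frontier₂ (hHILL : PRGExist_iff_OWFExist)
    (hq : Literature.Barriers.QuantumAdvantage.aaronsonChen2017_lem75_quantum) (howf : OWFExist) :
    PPolyOracleSeparation :=
  aaronsonChen2017_thm76_of_frontier₂ hHILL hq howf

/-- **The barrier `PPolyOracles` (Thms. 7.6 ∧ 8.1) from the same two named facts**, Thm. 8.1 being
the tree theorem `aaronsonChen2017_thm81_holds`. The discharge `PPolyOracles_holds` is this theorem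
applied to `PRGExist_iff_OWFExist_holds` and `aaronsonChen2017_lem75_quantum_holds` once they land.
[cite: AaronsonChen2017, Thm. 7.6 (p. 30) and Thm. 8.1 (p. 32)] -/
theorem PPolyOracles_of_frontier₂ (hHILL : PRGExist_iff_OWFExist)
    (hq : Literature.Barriers.QuantumAdvantage.aaronsonChen2017_lem75_quantum) : PPolyOracles :=
  PPolyOracles_of_thm76 (aaronsonChen2017_thm76_of_frontier₂ hHILL hq)

end Literature.Barriers.QuantumAdvantage

namespace Literature.Computability.Cryptography

/-- **`PRPExist_of_PRFExist` is a theorem of the tree (audit alias).** The named fact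
`PRPExist_of_PRFExist` (`PseudorandomPermutations.lean`): Luby–Rackoff: pseudorandom functions
yield pseudorandom permutations ("if `f^n` is pseudo-random then `p^{2n}` is also
pseudo-random": … — is proved, with exactly this statement, by `PRPExist_of_luby_rackoff`
(this file); this alias records the discharge under the census/audit name
`PRPExist_of_PRFExist_holds` (librarian sweep g25, pass 5c; no new mathematics).
[cite: LubyRackoff1988, abstract (main result)]
[cite: AaronsonChen2017, Lemma 7.4] -/
theorem PRPExist_of_PRFExist_holds :
    PRPExist_of_PRFExist :=
  Literature.Barriers.QuantumAdvantage.PRPExist_of_luby_rackoff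

end Literature.Computability.Cryptography
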